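import Literature.NumberTheory.EllipticCurves.IwasawaEulerCharDualityProofs
import Mathlib.Algebra.Module.CharacterModule
import Mathlib.GroupTheory.Torsion
import HarnessLib

/-!
# The torsion of the Pontryagin dual of `D ⊕ F` (`D` divisible, `F` finite) is `F^∨`; `#(B^∨)_tors = #F`

Topic `NumberTheory/EllipticCurves`, namespace `Literature.NumberTheory.EllipticCurves.PontryaginCard`
(continuing `IwasawaEulerCharDualityProofs`, whose `natCard_characterModule : #Hom(A, ℚ/ℤ) = #A` is used).
THEOREMS ONLY (Mathlib's `CharacterModule A = A →+ ℚ/ℤ`, `AddCommGroup.torsion`); no definition, no named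
fact, no instance, no `sorry` (D-0014/D-0026).

Cell `pub/bsd-print-x9`, seat `bsd-line-x9-p1-w2` (g5), for the shared μ-item of rows 9/10 (THE CUT v2,
`HeegnerMuPartStabilized.MuPartStabilizedCoherentPair`): the printed output of the DVR Kolyvagin bound
(Howard, Compositio 140 (2004), Thm. 1.6.1 / Prop. 2.1.3: `H¹_𝓕(K, A_𝔮) ≅ 𝒟_𝔮 ⊕ M_𝔮 ⊕ M_𝔮` with
`𝒟_𝔮 = Φ_𝔮/S_𝔮` DIVISIBLE and `M_𝔮` FINITE; Mastella–Zerman 2026 Thm. 2.40 `H¹_𝓛(K, 𝐀) ≅ Φ/𝓡 ⊕ M ⊕ M`) is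
consumed by the tree's witness interface (`Theorems/PrintX9MuPartSpecWitnessDefs`, field
`card_torsion_le_sq : #(Xq)_tors ≤ #(H/Rκ₁)²`) through the Pontryagin dual `Xq = Hom(H¹_𝓕(K, A_𝔮), ℚ/ℤ)`.
This file is the abelian-group bookkeeping of that dualisation, in the generality «`B ≃ D × F`, `D`
divisible, `F` finite»:

* `torsion_characterModule_eq_bot_of_divisible` — the dual of a divisible group is torsion-free;
* `torsion_characterModule_eq_top_of_finite` — the dual of a finite group is torsion;
* `nonempty_torsion_characterModule_addEquiv` — `(B^∨)_tors ≃+ F^∨` (restriction to `F`);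
* `finite_torsion_characterModule`, `natCard_torsion_characterModule` — `(B^∨)_tors` is finite of
  cardinality `#F`;
* `natCard_torsion_congr`, `finite_torsion_congr` — transport of the torsion subgroup along `≃+`.

References: [GreenbergLNM1716] R. Greenberg, *Iwasawa theory for elliptic curves*, LNM 1716 (1999), §4 p. 98
(«the torsion subgroup of `X/θ_n X` is then dual to `Sel_E(F_∞)_p^{Γ_n}/(Sel_E(F_∞)_p^{Γ_n})_div`» — the
principle formalised here: the torsion of a Pontryagin dual is the dual of the quotient by the divisible part);
consumer shape [Howard2004HeegnerKolyvagin] Thm. 1.6.1, [MastellaZerman2026] Thm. 2.40.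
-/

noncomputable section

open scoped Classical

universe u v w

namespace Literature.NumberTheory.EllipticCurves

namespace PontryaginCard

/-- **The Pontryagin dual of a divisible group is torsion-free**: if every `d ∈ D` is an `n`-th multiple
for every `n ≠ 0`, then `Hom(D, ℚ/ℤ)_tors = 0` (a character `χ` with `n χ = 0` satisfies
`χ(d) = χ(n d') = (n χ)(d') = 0`). [cite: GreenbergLNM1716, §4 p. 98 (torsion of the Pontryagin dual = dual of the quotient by the maximal divisible subgroup)] -/
theorem torsion_characterModule_eq_bot_of_divisible {D : Type u} [AddCommGroup D]
    (hD : ∀ n : ℕ, n ≠ 0 → ∀ d : D, ∃ d' : D, n • d' = d) :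
    AddCommGroup.torsion (CharacterModule D) = ⊥ := by
  rw [eq_bot_iff]
  intro χ hχ
  rw [AddSubgroup.mem_bot]
  obtain ⟨n, hn, hnχ⟩ :=
    isOfFinAddOrder_iff_nsmul_eq_zero.mp ((AddCommGroup.mem_torsion χ).mp hχ)
  refine CharacterModule.ext (A := D) fun d ↦ ?_
  obtain ⟨d', rfl⟩ := hD n hn.ne' d
  have h1 : χ (n • d') = (n • χ) d' := by
    rw [map_nsmul]
    rfl
  rw [h1, hnχ]
  rfl

/-- **The Pontryagin dual of a finite group is a torsion group**: `Hom(F, ℚ/ℤ)_tors = Hom(F, ℚ/ℤ)`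
(`Hom(F, ℚ/ℤ)` is finite, `PontryaginCard.finite_characterModule_of_finite`). [cite: GreenbergLNM1716, §4 p. 98 (torsion of the Pontryagin dual = dual of the quotient by the maximal divisible subgroup)] -/
theorem torsion_characterModule_eq_top_of_finite (F : Type u) [AddCommGroup F] [Finite F] :
    AddCommGroup.torsion (CharacterModule F) = ⊤ := by
  haveI := finite_characterModule_of_finite F
  exact AddCommGroup.torsion_eq_top_iff.mpr fun χ ↦ isOfFinAddOrder_of_finite χ

/-- A character of `B ≃ D × F` (`D` divisible) of finite order vanishes on `D`. [cite: GreenbergLNM1716, §4 p. 98 (torsion of the Pontryagin dual = dual of the quotient by the maximal divisible subgroup)] -/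
theorem apply_symm_inl_eq_zero_of_mem_torsion {B : Type u} {D : Type v} {F : Type w}
    [AddCommGroup B] [AddCommGroup D] [AddCommGroup F] (eB : B ≃+ D × F)
    (hD : ∀ n : ℕ, n ≠ 0 → ∀ d : D, ∃ d' : D, n • d' = d)
    {χ : CharacterModule B} (hχ : χ ∈ AddCommGroup.torsion (CharacterModule B)) (d : D) :
    χ (eB.symm (d, 0)) = 0 := by
  -- the restriction of `χ` to `D` is a torsion character of a divisible group
  let ιD : D →+ B := eB.symm.toAddMonoidHom.comp (AddMonoidHom.inl D F)
  let χD : CharacterModule D := (χ : B →+ AddCircle (1 : ℚ)).comp ιD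
  have hχD : χD ∈ AddCommGroup.torsion (CharacterModule D) := by
    rw [AddCommGroup.mem_torsion] at hχ ⊢
    obtain ⟨n, hn, hnχ⟩ := isOfFinAddOrder_iff_nsmul_eq_zero.mp hχ
    refine isOfFinAddOrder_iff_nsmul_eq_zero.mpr ⟨n, hn, ?_⟩
    refine CharacterModule.ext (A := D) fun x ↦ ?_
    have h1 : (n • χD) x = (n • χ) (ιD x) := rfl
    rw [h1, hnχ]
    rfl
  rw [torsion_characterModule_eq_bot_of_divisible hD, AddSubgroup.mem_bot] at hχD
  have := DFunLike.congr_fun hχD d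
  exact this

/-- **`(B^∨)_tors ≃ F^∨` for `B ≃ D × F` with `D` divisible and `F` finite**: restriction of characters
along `F ↪ D × F ≃ B` is an isomorphism from the torsion characters of `B` onto `Hom(F, ℚ/ℤ)` (injective
because a torsion character kills the divisible `D`; surjective because `ψ ∘ pr_F` is torsion, `Hom(F, ℚ/ℤ)`
being finite). The shape `H¹_𝓕(K, A) ≅ 𝒟 ⊕ M ⊕ M ⟹ (H¹_𝓕(K, A)^∨)_tors ≅ (M ⊕ M)^∨` of the DVR
Kolyvagin bound. [cite: GreenbergLNM1716, §4 p. 98 (torsion of the Pontryagin dual = dual of the quotient by the maximal divisible subgroup)]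
[cite: Howard2004HeegnerKolyvagin, Thm. 1.6.1 (shape H¹(K,A) = D + M + M)] -/
theorem nonempty_torsion_characterModule_addEquiv {B : Type u} {D : Type v} {F : Type w}
    [AddCommGroup B] [AddCommGroup D] [AddCommGroup F] [Finite F] (eB : B ≃+ D × F)
    (hD : ∀ n : ℕ, n ≠ 0 → ∀ d : D, ∃ d' : D, n • d' = d) :
    Nonempty (AddCommGroup.torsion (CharacterModule B) ≃+ CharacterModule F) := by
  let ιF : F →+ B := eB.symm.toAddMonoidHom.comp (AddMonoidHom.inr D F)
  let r : AddCommGroup.torsion (CharacterModule B) →+ CharacterModule F :=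
    { toFun := fun χ ↦ (χ.1 : B →+ AddCircle (1 : ℚ)).comp ιF
      map_zero' := rfl
      map_add' := fun _ _ ↦ rfl }
  have hr : ∀ (χ : AddCommGroup.torsion (CharacterModule B)) (x : F),
      r χ x = (χ.1 : CharacterModule B) (eB.symm (0, x)) := fun _ _ ↦ rfl
  refine ⟨AddEquiv.ofBijective r ⟨?_, ?_⟩⟩
  · -- injective: a torsion character vanishing on `F` vanishes on `D` as well
    rw [injective_iff_map_eq_zero]
    rintro ⟨χ, hχ⟩ h0
    refine Subtype.ext (CharacterModule.ext (A := B) fun b ↦ ?_)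
    obtain ⟨⟨d, x⟩, rfl⟩ := eB.symm.surjective b
    have hsplit : eB.symm (d, x) = eB.symm (d, 0) + eB.symm (0, x) := by
      rw [← map_add, Prod.mk_add_mk, add_zero, zero_add]
    have hx : χ (eB.symm (0, x)) = 0 := by
      rw [← hr ⟨χ, hχ⟩ x, h0]
      rfl
    rw [hsplit, map_add, apply_symm_inl_eq_zero_of_mem_torsion eB hD hχ d, hx, add_zero]
    rfl
  · -- surjective: `ψ ∘ pr_F ∘ eB` is a torsion character restricting to `ψ`
    intro ψ
    let χ : CharacterModule B :=
      (ψ : F →+ AddCircle (1 : ℚ)).comp ((AddMonoidHom.snd D F).comp eB.toAddMonoidHom)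
    have hχapp : ∀ b : B, χ b = ψ (eB b).2 := fun _ ↦ rfl
    have hχ : χ ∈ AddCommGroup.torsion (CharacterModule B) := by
      haveI := finite_characterModule_of_finite F
      rw [AddCommGroup.mem_torsion]
      obtain ⟨n, hn, hnψ⟩ := isOfFinAddOrder_iff_nsmul_eq_zero.mp (isOfFinAddOrder_of_finite ψ)
      refine isOfFinAddOrder_iff_nsmul_eq_zero.mpr ⟨n, hn, ?_⟩
      refine CharacterModule.ext (A := B) fun b ↦ ?_
      have h1 : (n • χ) b = (n • ψ) (eB b).2 := rfl
      rw [h1, hnψ]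
      rfl
    refine ⟨⟨χ, hχ⟩, CharacterModule.ext (A := F) fun x ↦ ?_⟩
    rw [hr, hχapp, AddEquiv.apply_symm_apply]

/-- `(B^∨)_tors` is finite when `B ≃ D × F` with `D` divisible and `F` finite. [cite: GreenbergLNM1716, §4 p. 98 (torsion of the Pontryagin dual = dual of the quotient by the maximal divisible subgroup)] -/
theorem finite_torsion_characterModule {B : Type u} {D : Type v} {F : Type w}
    [AddCommGroup B] [AddCommGroup D] [AddCommGroup F] [Finite F] (eB : B ≃+ D × F)
    (hD : ∀ n : ℕ, n ≠ 0 → ∀ d : D, ∃ d' : D, n • d' = d) :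
    Finite (AddCommGroup.torsion (CharacterModule B)) := by
  obtain ⟨e⟩ := nonempty_torsion_characterModule_addEquiv eB hD
  haveI := finite_characterModule_of_finite F
  exact Finite.of_equiv _ e.toEquiv.symm

/-- **`#(B^∨)_tors = #F`** when `B ≃ D × F` with `D` divisible and `F` finite
(`(B^∨)_tors ≃ F^∨` and `#F^∨ = #F`, `PontryaginCard.natCard_characterModule`). [cite: GreenbergLNM1716, §4 p. 98 (torsion of the Pontryagin dual = dual of the quotient by the maximal divisible subgroup)]
[cite: Howard2004HeegnerKolyvagin, Thm. 1.6.1 (shape H¹(K,A) = D + M + M)] -/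
theorem natCard_torsion_characterModule {B : Type u} {D : Type v} {F : Type w}
    [AddCommGroup B] [AddCommGroup D] [AddCommGroup F] [Finite F] (eB : B ≃+ D × F)
    (hD : ∀ n : ℕ, n ≠ 0 → ∀ d : D, ∃ d' : D, n • d' = d) :
    Nat.card (AddCommGroup.torsion (CharacterModule B)) = Nat.card F := by
  obtain ⟨e⟩ := nonempty_torsion_characterModule_addEquiv eB hD
  rw [Nat.card_congr e.toEquiv, natCard_characterModule]

/-- Transport of the torsion subgroup along an additive isomorphism: `G_tors ≃ H_tors`, counted (bookkeeping for
the same dualisation). [cite: GreenbergLNM1716, §4 p. 98 (torsion of the Pontryagin dual = dual of the quotient by the maximal divisible subgroup)] -/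
theorem natCard_torsion_congr {G : Type u} {H : Type v} [AddCommGroup G] [AddCommGroup H]
    (e : G ≃+ H) : Nat.card (AddCommGroup.torsion G) = Nat.card (AddCommGroup.torsion H) := by
  rw [← AddEquiv.map_torsion e]
  exact Nat.card_congr (e.addSubgroupMap (AddCommGroup.torsion G)).toEquiv

/-- Transport of finiteness of the torsion subgroup along an additive isomorphism (bookkeeping for the same
dualisation). [cite: GreenbergLNM1716, §4 p. 98 (torsion of the Pontryagin dual = dual of the quotient by the maximal divisible subgroup)] -/
theorem finite_torsion_congr {G : Type u} {H : Type v} [AddCommGroup G] [AddCommGroup H]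
    (e : G ≃+ H) : Finite (AddCommGroup.torsion G) ↔ Finite (AddCommGroup.torsion H) := by
  rw [← AddEquiv.map_torsion e]
  exact Equiv.finite_iff (e.addSubgroupMap (AddCommGroup.torsion G)).toEquiv

end PontryaginCard

end Literature.NumberTheory.EllipticCurves

end
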